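import Literature.Barriers.CriticalPhenomena.RigorousRGSmallParameterTorusCovariance
import HarnessLib

/-!
# `RigorousRGSmallParameter` (Slade, Theorem 1.4.1): the estimate (3.10) on the torus term
# `C_{N,N}` of the covariance decomposition (Proposition 3.3.1, `a = 0`)

Companion of `RigorousRGSmallParameterTorusCovariance.lean` (`C_{N,N} = FRD.fracCovNN`, (3.7) on
the torus) and `RigorousRGSmallParameterCovarianceBound.lean` ((3.9) with the absolute value
inside the `s`-integral) in the proof architecture of the barrier `RigorousRGSmallParameter.lean`.
Source: G. Slade, *Critical exponents for long-range `O(n)` models below the upper critical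
dimension*, Commun. Math. Phys. 358 (2018) 343–436, Proposition 3.3.1: "For `m² ∈ (0,m̄²]`,
(3.10) `|∇^aC_{N,N;x,y}| ≤ cL^{-(d-α+|a|)(N-1)} (m²L^{α(N-1)})^{-2}`. The constant `c` may depend
on `m̄², ā`, but does not depend on `m², L, j, N`", and its proof in §10.1: "Assuming (10.3),
we obtain (10.4) easily, as follows. By definition, `C_{N,N;x,y} = Σ_{z∈ℤ^d}Σ_{j=N}^∞
C_{j;x,y+zL^N}`. Since we assume `m² ≤ m̄²`, the second term on the right-hand side of (10.3) is
dominated by the first term. Therefore, by the finite-range property of `C_j`,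
`|∇^aC_{N,N;x,y}| ≲ Σ_{j=N}^∞ L^{d(j-N)} L^{-(j-1)(d-α+|a|)} (1+m⁴L^{2α(j-1)})⁻¹ ≤
m⁻⁴L^{-d(N-1)} Σ_{j=N}^∞ L^{-(j-1)(α+|a|)} ≲ m⁻⁴ L^{-(N-1)(d+α+|a|)}`, as required."
Here `a = 0`, `M = L^N` with `L ≥ 2` an integer, and the explicit [Baue13a]/BBS decomposition.

## What this file proves (everything; no definition and no named fact is introduced)

* `FRD.card_periodiseIndex_le` — the number of translates `z` with `|x̃-ỹ-Mz|₁ < r` is at most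
  `(2r/M+1)^d` ("`L^{d(j-N)}`" for `r = ½L^j`, `M = L^N`).
* `FRD.ofReal_abs_GamTail_le`, `FRD.ofReal_abs_GamNN_le` —
  `|Γ_{N,N;x,y}(s)| ≤ Σ_zΣ_{j≥N}|Γ_j(x̃-ỹ-Mz)(s)|` (in `ℝ≥0∞`).
* `FRD.integrableOn_abs_Gam_mul_katoDensity`, `FRD.measurable_ofReal_abs_Gam_mul`,
  `FRD.integrableOn_abs_GamNN_mul_katoDensity`, `FRD.lintegral_abs_GamNN_mul_le` — Tonelli:
  `∫₀^∞|Γ_{N,N;x,y}(s)|ρ ds ≤ Σ_zΣ_{j≥N}∫₀^∞|Γ_j(x̃-ỹ-Mz)(s)|ρ ds` (in `ℝ≥0∞`).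
* `FRD.pow_count_le`, `FRD.two_terms_le` — the power counting of the printed proof
  (`(L^m+1)^d(L^{m+N-1})^{-(α+d)} ≤ 2^d(L^{-α})^m(L^{N-1})^{-(α+d)}`; the second term of (10.3) at
  `p' = 2α` is at most `m̄²×` the first for `m² ≤ m̄²`).
* **`FRD.Slade2017_prop331_CNN_estimate`** — **(3.10) = (10.4) with `a = 0`, PROVED**: for
  `d ≥ 1`, `α ∈ (0,2∧d)`, `m̄² > 0` there is `c > 0` (independent of `m², L, N, x, y`) with
  `|C_{N,N;x,y}(m²)| ≤ c (L^{N-1})^{α-d} (m²(L^{N-1})^α)^{-2}` for all integers `L ≥ 2`, all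
  `m² ∈ (0,m̄²]`, `N ≥ 1`, on the torus of side `M = L^N`, all `x, y`.
-/

noncomputable section

namespace Literature.Barriers.CriticalPhenomena

open _root_.MeasureTheory Set Filter
open scoped _root_.Topology Real ENNReal

namespace LongRangePhi4

namespace FRD

open Literature.Probability.LatticeModels

variable {d : ℕ}

/-! ### Counting the translates -/

/-- **The number of `z ∈ ℤ^d` with `|w-Mz|₁ < r` is at most `(2r/M+1)^d`** (each coordinate
`z_i` lies in an interval of length `2r/M`). This is the factor "`L^{d(j-N)}`" of the printed
proof (`r = ½L^j`, `M = L^N`). [cite: Slade2017, §10.1 (proof of (10.4): "by the finite-range property of C_j, … Σ_j L^{d(j-N)} …")] -/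
theorem card_periodiseIndex_le {M : ℕ} [NeZero M] (x y : TorusSite d M) {r : ℝ} (hr : 0 ≤ r) :
    (((finite_periodiseIndex x y r).toFinset.card : ℕ) : ℝ) ≤ (2 * r / M + 1) ^ d := by
  classical
  have hM : (0 : ℝ) < M := by exact_mod_cast Nat.pos_of_ne_zero (NeZero.ne M)
  set w : Site d := (fun j => ((x j).val : ℤ)) - fun j => ((y j).val : ℤ) with hw
  set lo : Fin d → ℤ := fun i => ⌈((w i : ℝ) - r) / M⌉ with hlo
  set hi : Fin d → ℤ := fun i => ⌊((w i : ℝ) + r) / M⌋ with hhi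
  set T : Finset (Site d) := Fintype.piFinset fun i => Finset.Icc (lo i) (hi i) with hT
  have hsub : (finite_periodiseIndex x y r).toFinset ⊆ T := by
    intro z hz
    rw [Set.Finite.mem_toFinset] at hz
    have hz' : (((∑ i, (((fun j => ((x j).val : ℤ)) - fun j => ((y j).val : ℤ) + M * z j) i).natAbs
      : ℕ) : ℝ)) < r := hz
    rw [hT, Fintype.mem_piFinset]
    intro i
    have h1 : ((((fun j => ((x j).val : ℤ)) - fun j => ((y j).val : ℤ) + M * z j) i).natAbs : ℝ) < r := by
      refine lt_of_le_of_lt ?_ hz'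
      exact_mod_cast Finset.single_le_sum (f := fun k => (((fun j => ((x j).val : ℤ)) -
        fun j => ((y j).val : ℤ) + M * z j) k).natAbs) (fun k _ => Nat.zero_le _) (Finset.mem_univ i)
    have h2 : (((fun j => ((x j).val : ℤ)) - fun j => ((y j).val : ℤ) + M * z j) i) = w i - M * z i := by
      simp only [hw, Pi.sub_apply]
      ring
    rw [h2, ← Int.cast_natCast, Int.natCast_natAbs, Int.cast_abs] at h1
    have h3 : |((w i - M * z i : ℤ) : ℝ)| < r := h1
    rw [abs_lt] at h3
    push_cast at h3
    obtain ⟨h3a, h3b⟩ := h3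
    rw [Finset.mem_Icc]
    constructor
    · rw [hlo, Int.ceil_le, div_le_iff₀ hM]
      nlinarith
    · rw [hhi, Int.le_floor, le_div_iff₀ hM]
      nlinarith
  have hcard : (((finite_periodiseIndex x y r).toFinset.card : ℕ) : ℝ) ≤ ((T.card : ℕ) : ℝ) := by
    exact_mod_cast Finset.card_le_card hsub
  refine hcard.trans ?_
  rw [hT, Fintype.card_piFinset]
  push_cast
  have hprod : (2 * r / M + 1) ^ d = ∏ _i : Fin d, (2 * r / M + 1) := by
    rw [Finset.prod_const, Finset.card_univ, Fintype.card_fin]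
  rw [hprod]
  refine Finset.prod_le_prod (fun i _ => by positivity) fun i _ => ?_
  rw [Int.card_Icc]
  have hlo' : ((w i : ℝ) - r) / M ≤ (lo i : ℝ) := Int.le_ceil _
  have hhi' : (hi i : ℝ) ≤ ((w i : ℝ) + r) / M := Int.floor_le _
  have hlen : ((hi i : ℝ) + 1 - lo i) ≤ 2 * r / M + 1 := by
    have : ((w i : ℝ) + r) / M - ((w i : ℝ) - r) / M = 2 * r / M := by ring
    linarith
  rcases le_or_gt (hi i + 1 - lo i) 0 with hneg | hpos
  · rw [Int.toNat_of_nonpos hneg]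
    simp only [CharP.cast_eq_zero]
    positivity
  · have : (((hi i + 1 - lo i).toNat : ℕ) : ℝ) = ((hi i + 1 - lo i : ℤ) : ℝ) := by
      rw [← Int.cast_natCast, Int.toNat_of_nonneg hpos.le]
    rw [this]
    push_cast
    exact hlen

/-! ### `|Γ_{N,N}(s)| ≤ Σ_zΣ_{j≥N}|Γ_j|` and Tonelli (in `ℝ≥0∞`) -/

/-- `|Σ_{j≥N}Γ_j(c)(s)| ≤ Σ_{j≥N}|Γ_j(c)(s)|` in `ℝ≥0∞`. [folklore] -/
theorem ofReal_abs_GamTail_le {L : ℝ} (hL : 1 < L) {s : ℝ} (hs : 0 < s) (N : ℕ) (c : Site d) :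
    ENNReal.ofReal |GamTail d L s N c| ≤ ∑' m : ℕ, ENNReal.ofReal |Gam d L s (m + N) c| := by
  have h := hasSum_GamTail hL hs N c
  have hsum : Summable fun m : ℕ => ‖Gam d L s (m + N) c‖ := h.summable.norm
  calc ENNReal.ofReal |GamTail d L s N c| ≤ ENNReal.ofReal (∑' m : ℕ, |Gam d L s (m + N) c|) := by
        refine ENNReal.ofReal_le_ofReal ?_
        rw [← h.tsum_eq]
        have := norm_tsum_le_tsum_norm hsum
        simpa only [Real.norm_eq_abs] using this
    _ = ∑' m : ℕ, ENNReal.ofReal |Gam d L s (m + N) c| :=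
        ENNReal.ofReal_tsum_of_nonneg (fun m => abs_nonneg _) h.summable.abs

/-- **`|Γ_{N,N;x,y}(s)| ≤ Σ_{z∈ℤ^d}Σ_{j≥N}|Γ_j(x̃-ỹ-Mz)(s)|`** in `ℝ≥0∞` ("By definition,
`C_{N,N;x,y} = Σ_zΣ_{j≥N}C_{j;x,y+zL^N}`", at the level of the `Γ`'s).
[cite: Slade2017, §3.1 (display (3.4)) and §10.1 (proof of (10.4))] -/
theorem ofReal_abs_GamNN_le (hd : 1 ≤ d) {M : ℕ} [NeZero M] {L : ℝ} (hL : 1 < L) {s : ℝ}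
    (hs : 0 < s) {N : ℕ} (hN : 1 ≤ N) (x y : TorusSite d M) :
    ENNReal.ofReal |GamNN d L s N M x y| ≤
      ∑' z : Site d, ∑' m : ℕ, ENNReal.ofReal
        |Gam d L s (m + N) ((fun j => ((x j).val : ℤ)) - fun j => ((y j).val : ℤ) + M * z j)| := by
  have hrow := summable_GamTail_sub hd hL hs hN (fun j => ((x j).val : ℤ))
  have hper := hasSum_periodise (fun a b => GamTail d L s N (a - b)) x y hrow
  have hinj : Function.Injective fun z : Site d => (fun j => ((y j).val : ℤ) + M * z j : Site d) := by
    intro z₁ z₂ h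
    funext j
    have hj := congr_fun h j
    simpa [NeZero.ne M] using hj
  have h1 : Summable fun z : Site d =>
      GamTail d L s N ((fun j => ((x j).val : ℤ)) - fun j => ((y j).val : ℤ) + M * z j) :=
    hrow.comp_injective hinj
  unfold GamNN
  rw [← hper.tsum_eq]
  calc ENNReal.ofReal |∑' z : Site d,
        GamTail d L s N ((fun j => ((x j).val : ℤ)) - fun j => ((y j).val : ℤ) + M * z j)|
      ≤ ENNReal.ofReal (∑' z : Site d,
        |GamTail d L s N ((fun j => ((x j).val : ℤ)) - fun j => ((y j).val : ℤ) + M * z j)|) := by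
        refine ENNReal.ofReal_le_ofReal ?_
        have := norm_tsum_le_tsum_norm h1.norm
        simpa only [Real.norm_eq_abs] using this
    _ = ∑' z : Site d, ENNReal.ofReal
        |GamTail d L s N ((fun j => ((x j).val : ℤ)) - fun j => ((y j).val : ℤ) + M * z j)| :=
        ENNReal.ofReal_tsum_of_nonneg (fun z => abs_nonneg _) h1.abs
    _ ≤ _ := ENNReal.tsum_le_tsum fun z => ofReal_abs_GamTail_le hL hs N _

/-- `s ↦ |Γ_j(c)(s)|ρ^{(β)}(s,m²)` is integrable on `(0,∞)` (`m² > 0`). [folklore] -/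
theorem integrableOn_abs_Gam_mul_katoDensity (hd : 1 ≤ d) {β : ℝ} (hβ0 : 0 < β) (hβ1 : β < 1)
    {L : ℝ} (hL : 1 < L) {m2 : ℝ} (hm2 : 0 < m2) {j : ℕ} (hj : 1 ≤ j) (c : Site d) :
    IntegrableOn (fun s : ℝ => |Gam d L s j c| * Kato.katoDensity β m2 s) (Ioi 0) := by
  refine ((integrableOn_Gam_mul_katoDensity hd hβ0 hβ1 hL hm2 hj c).norm).congr ?_
  refine (ae_restrict_iff' measurableSet_Ioi).2 (Eventually.of_forall fun s hs => ?_)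
  have hs : (0 : ℝ) < s := hs
  simp only
  rw [Real.norm_eq_abs, abs_mul, abs_of_nonneg (Kato.katoDensity_pos hβ0 hβ1 m2 hs).le]

/-- Measurability of `s ↦ |Γ_j(c)(s)|ρ(s,m²)` in `ℝ≥0∞`. [folklore] -/
theorem measurable_ofReal_abs_Gam_mul (L : ℝ) (β m2 : ℝ) (j : ℕ) (c : Site d) :
    Measurable fun s : ℝ => ENNReal.ofReal (|Gam d L s j c| * Kato.katoDensity β m2 s) :=
  ((continuous_abs.measurable.comp (measurable_Gam L j c)).mul
    (Kato.measurable_katoDensity β m2)).ennreal_ofReal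

/-- **Tonelli: `∫₀^∞|Γ_{N,N;x,y}(s)|ρ(s,m²)ds ≤ Σ_zΣ_{j≥N}∫₀^∞|Γ_j(x̃-ỹ-Mz)(s)|ρ(s,m²)ds`**
(in `ℝ≥0∞`; the interchange behind "`C_{N,N;x,y} = Σ_zΣ_{j≥N}C_{j;x,y+zL^N}`").
[cite: Slade2017, §10.1 (proof of (10.4), first display)] -/
theorem lintegral_abs_GamNN_mul_le (hd : 1 ≤ d) {M : ℕ} [NeZero M] {β : ℝ} (hβ0 : 0 < β)
    (hβ1 : β < 1) {L : ℝ} (hL : 1 < L) {m2 : ℝ} (hm2 : 0 < m2) {N : ℕ} (hN : 1 ≤ N)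
    (x y : TorusSite d M) :
    ∫⁻ s in Ioi 0, ENNReal.ofReal (|GamNN d L s N M x y| * Kato.katoDensity β m2 s) ≤
      ∑' z : Site d, ∑' m : ℕ, ENNReal.ofReal (∫ s in Ioi 0,
        |Gam d L s (m + N) ((fun j => ((x j).val : ℤ)) - fun j => ((y j).val : ℤ) + M * z j)| *
          Kato.katoDensity β m2 s) := by
  set c : Site d → Site d := fun z => (fun j => ((x j).val : ℤ)) - fun j => ((y j).val : ℤ) + M * z j
    with hc
  calc ∫⁻ s in Ioi 0, ENNReal.ofReal (|GamNN d L s N M x y| * Kato.katoDensity β m2 s)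
      ≤ ∫⁻ s in Ioi 0, ∑' z : Site d, ∑' m : ℕ,
          ENNReal.ofReal (|Gam d L s (m + N) (c z)| * Kato.katoDensity β m2 s) := by
        refine setLIntegral_mono' measurableSet_Ioi fun s hs => ?_
        have hs : (0 : ℝ) < s := hs
        have hρ0 := (Kato.katoDensity_pos hβ0 hβ1 m2 hs).le
        rw [ENNReal.ofReal_mul (abs_nonneg _)]
        calc ENNReal.ofReal |GamNN d L s N M x y| * ENNReal.ofReal (Kato.katoDensity β m2 s)
            ≤ (∑' z : Site d, ∑' m : ℕ, ENNReal.ofReal |Gam d L s (m + N) (c z)|) *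
                ENNReal.ofReal (Kato.katoDensity β m2 s) :=
              mul_le_mul_of_nonneg_right (ofReal_abs_GamNN_le hd hL hs hN x y) bot_le
          _ = ∑' z : Site d, ∑' m : ℕ,
                ENNReal.ofReal |Gam d L s (m + N) (c z)| * ENNReal.ofReal (Kato.katoDensity β m2 s) := by
              rw [← ENNReal.tsum_mul_right]
              refine tsum_congr fun z => ?_
              rw [← ENNReal.tsum_mul_right]
          _ = ∑' z : Site d, ∑' m : ℕ,
                ENNReal.ofReal (|Gam d L s (m + N) (c z)| * Kato.katoDensity β m2 s) := by
              refine tsum_congr fun z => tsum_congr fun m => ?_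
              rw [ENNReal.ofReal_mul (abs_nonneg _)]
    _ = ∑' z : Site d, ∫⁻ s in Ioi 0, ∑' m : ℕ,
          ENNReal.ofReal (|Gam d L s (m + N) (c z)| * Kato.katoDensity β m2 s) :=
        lintegral_tsum fun z => (Measurable.tsum fun m =>
          measurable_ofReal_abs_Gam_mul L β m2 (m + N) (c z)).aemeasurable
    _ = ∑' z : Site d, ∑' m : ℕ, ∫⁻ s in Ioi 0,
          ENNReal.ofReal (|Gam d L s (m + N) (c z)| * Kato.katoDensity β m2 s) := by
        refine tsum_congr fun z => ?_
        exact lintegral_tsum fun m => (measurable_ofReal_abs_Gam_mul L β m2 (m + N) (c z)).aemeasurable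
    _ = _ := by
        refine tsum_congr fun z => tsum_congr fun m => ?_
        rw [← ofReal_integral_eq_lintegral_ofReal
          (integrableOn_abs_Gam_mul_katoDensity hd hβ0 hβ1 hL hm2 (by omega) (c z))]
        refine (ae_restrict_iff' measurableSet_Ioi).2 (Eventually.of_forall fun s hs => ?_)
        have hs : (0 : ℝ) < s := hs
        exact mul_nonneg (abs_nonneg _) (Kato.katoDensity_pos hβ0 hβ1 m2 hs).le

/-- `s ↦ |Γ_{N,N;x,y}(s)|ρ^{(β)}(s,m²)` is integrable on `(0,∞)` (`m² > 0`). [folklore] -/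
theorem integrableOn_abs_GamNN_mul_katoDensity (hd : 1 ≤ d) {M : ℕ} [NeZero M] {β : ℝ}
    (hβ0 : 0 < β) (hβ1 : β < 1) {L : ℝ} (hL : 1 < L) {m2 : ℝ} (hm2 : 0 < m2) {N : ℕ} (hN : 1 ≤ N)
    (x y : TorusSite d M) :
    IntegrableOn (fun s : ℝ => |GamNN d L s N M x y| * Kato.katoDensity β m2 s) (Ioi 0) := by
  refine ((integrableOn_GamNN_mul_katoDensity hd hβ0 hβ1 hL hm2 hN x y).norm).congr ?_
  refine (ae_restrict_iff' measurableSet_Ioi).2 (Eventually.of_forall fun s hs => ?_)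
  have hs : (0 : ℝ) < s := hs
  simp only
  rw [Real.norm_eq_abs, abs_mul, abs_of_nonneg (Kato.katoDensity_pos hβ0 hβ1 m2 hs).le]

/-- Power counting for (10.4): `(L^m+1)^d (L^{m+N-1})^{-(α+d)} ≤ 2^d (L^{-α})^m (L^{N-1})^{-(α+d)}`
(`L ≥ 1`, `N ≥ 1`, any real `α`). [cite: Slade2017, §10.1 (proof of (10.4): "L^{d(j-N)} L^{-(j-1)(d-α)} … ≤ L^{-d(N-1)} Σ_j L^{-(j-1)α}")] -/
theorem pow_count_le {L : ℝ} (hL : 1 ≤ L) (α : ℝ) {N : ℕ} (hN : 1 ≤ N) (m : ℕ) :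
    (L ^ m + 1) ^ d * (L ^ (m + N - 1)) ^ (-(α + d)) ≤
      2 ^ d * (L ^ (-α)) ^ m * (L ^ (N - 1)) ^ (-(α + d)) := by
  have hL0 : 0 < L := by linarith
  have hLm : 1 ≤ L ^ m := one_le_pow₀ hL
  have hLm0 : 0 < L ^ m := by linarith
  have hsplit : L ^ (m + N - 1) = L ^ m * L ^ (N - 1) := by
    rw [← pow_add]
    congr 1
    omega
  rw [hsplit, Real.mul_rpow hLm0.le (pow_nonneg hL0.le _)]
  have h1 : (L ^ m + 1) ^ d ≤ 2 ^ d * (L ^ m) ^ d := by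
    rw [← mul_pow]
    exact pow_le_pow_left₀ (by positivity) (by linarith) d
  have h2 : (L ^ m) ^ d * (L ^ m) ^ (-(α + d)) = (L ^ (-α)) ^ m := by
    rw [← Real.rpow_natCast (L ^ m) d, ← Real.rpow_add hLm0, ← Real.rpow_natCast L m,
      ← Real.rpow_mul hL0.le, ← Real.rpow_natCast (L ^ (-α)) m, ← Real.rpow_mul hL0.le]
    congr 1
    ring
  have h3 : 0 ≤ (L ^ (N - 1)) ^ (-(α + d)) := Real.rpow_nonneg (pow_nonneg hL0.le _) _
  have h4 : 0 ≤ (L ^ m) ^ (-(α + d)) := Real.rpow_nonneg hLm0.le _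
  calc (L ^ m + 1) ^ d * ((L ^ m) ^ (-(α + d)) * (L ^ (N - 1)) ^ (-(α + d)))
      ≤ 2 ^ d * (L ^ m) ^ d * ((L ^ m) ^ (-(α + d)) * (L ^ (N - 1)) ^ (-(α + d))) :=
        mul_le_mul_of_nonneg_right h1 (mul_nonneg h4 h3)
    _ = 2 ^ d * ((L ^ m) ^ d * (L ^ m) ^ (-(α + d))) * (L ^ (N - 1)) ^ (-(α + d)) := by ring
    _ = 2 ^ d * (L ^ (-α)) ^ m * (L ^ (N - 1)) ^ (-(α + d)) := by rw [h2]

/-- The two terms of (10.3) at `p' = 2α`, for `m² ≤ m̄²`: `ℓ^{α-d}(1/(1+m⁴ℓ^{2α}) +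
1/(1+m²ℓ^{2α})) ≤ (1+m̄²) m⁻⁴ ℓ^{-(α+d)}` (`ℓ > 0`) — "Since we assume `m² ≤ m̄²`, the second
term on the right-hand side of (10.3) is dominated by the first term".
[cite: Slade2017, §10.1 (proof of (10.4))] -/
theorem two_terms_le {ℓ : ℝ} (hℓ : 0 < ℓ) {α : ℝ} {m2 mbar : ℝ} (hm2 : 0 < m2) (hm2' : m2 ≤ mbar) :
    ℓ ^ (α - d) * (1 / (1 + m2 ^ 2 * ℓ ^ (2 * α)) + 1 / (1 + m2 * ℓ ^ (2 * α))) ≤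
      (1 + mbar) * (m2⁻¹ ^ 2 * ℓ ^ (-(α + d))) := by
  have hX : 0 < ℓ ^ (2 * α) := Real.rpow_pos_of_pos hℓ _
  have h1 : 1 / (1 + m2 ^ 2 * ℓ ^ (2 * α)) ≤ m2⁻¹ ^ 2 * (ℓ ^ (2 * α))⁻¹ := by
    rw [inv_pow, ← mul_inv, ← one_div]
    exact one_div_le_one_div_of_le (by positivity) (by linarith)
  have h2 : 1 / (1 + m2 * ℓ ^ (2 * α)) ≤ mbar * (m2⁻¹ ^ 2 * (ℓ ^ (2 * α))⁻¹) := by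
    have h2a : 1 / (1 + m2 * ℓ ^ (2 * α)) ≤ (m2 * ℓ ^ (2 * α))⁻¹ := by
      rw [← one_div]
      exact one_div_le_one_div_of_le (by positivity) (by linarith)
    have h2b : (m2 * ℓ ^ (2 * α))⁻¹ = m2 * (m2⁻¹ ^ 2 * (ℓ ^ (2 * α))⁻¹) := by
      field_simp
    rw [h2b] at h2a
    exact h2a.trans (mul_le_mul_of_nonneg_right hm2' (by positivity))
  have hsum : 1 / (1 + m2 ^ 2 * ℓ ^ (2 * α)) + 1 / (1 + m2 * ℓ ^ (2 * α)) ≤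
      (1 + mbar) * (m2⁻¹ ^ 2 * (ℓ ^ (2 * α))⁻¹) := by linarith
  have hpow : ℓ ^ (α - d) * (ℓ ^ (2 * α))⁻¹ = ℓ ^ (-(α + d)) := by
    rw [← Real.rpow_neg hℓ.le, ← Real.rpow_add hℓ]
    congr 1
    ring
  calc ℓ ^ (α - d) * (1 / (1 + m2 ^ 2 * ℓ ^ (2 * α)) + 1 / (1 + m2 * ℓ ^ (2 * α)))
      ≤ ℓ ^ (α - d) * ((1 + mbar) * (m2⁻¹ ^ 2 * (ℓ ^ (2 * α))⁻¹)) :=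
        mul_le_mul_of_nonneg_left hsum (Real.rpow_nonneg hℓ.le _)
    _ = (1 + mbar) * (m2⁻¹ ^ 2 * (ℓ ^ (α - d) * (ℓ ^ (2 * α))⁻¹)) := by ring
    _ = (1 + mbar) * (m2⁻¹ ^ 2 * ℓ ^ (-(α + d))) := by rw [hpow]

/-- **Slade, Proposition 3.3.1, estimate (3.10) = (10.4) with `a = 0`, PROVED** for the explicit
[Baue13a]/BBS decomposition: for `d ≥ 1`, `α ∈ (0,2∧d)` and `m̄² > 0` there is `c > 0` —
independent of `m², L, N, x, y` — such that for every integer `L ≥ 2`, every `m² ∈ (0,m̄²]`,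
every `N ≥ 1`, on the torus `Λ_N = (ℤ/L^Nℤ)^d` and for all `x, y ∈ Λ_N`:
`|C_{N,N;x,y}(m²)| ≤ c (L^{N-1})^{α-d} (m²(L^{N-1})^α)^{-2}`, i.e.
"`|C_{N,N;x,y}| ≤ cL^{-(d-α)(N-1)}(m²L^{α(N-1)})^{-2}`". Printed proof, followed:
`|C_{N,N}| ≤ Σ_zΣ_{j≥N}∫|Γ_j(x̃-ỹ-zL^N)|ρ` (Tonelli), at most `(L^{j-N}+1)^d` translates contribute
(finite range), each bounded by (10.3) at `p' = 2α` where the second term is dominated by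
`m̄²×` the first, and the geometric sum `Σ_{j≥N}L^{d(j-N)}L^{-(j-1)(d+α)}`.
[cite: Slade2017, Proposition 3.3.1 (display (3.10), a = 0)] [cite: Slade2017, §10.1 (Proposition 10.1.1, display (10.4); proof "Assuming (10.3), we obtain (10.4) easily")] -/
theorem Slade2017_prop331_CNN_estimate (hd : 1 ≤ d) {α : ℝ} (hα0 : 0 < α) (hα2 : α < 2)
    (hαd : α < d) {mbar : ℝ} (hmbar : 0 < mbar) :
    ∃ c : ℝ, 0 < c ∧ ∀ L : ℕ, 2 ≤ L → ∀ m2 : ℝ, 0 < m2 → m2 ≤ mbar → ∀ N : ℕ, 1 ≤ N →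
      ∀ (M : ℕ) [NeZero M], M = L ^ N → ∀ x y : TorusSite d M,
        |fracCovNN d L α m2 N M x y| ≤
          c * ((L : ℝ) ^ (N - 1)) ^ (α - d) * (m2 * ((L : ℝ) ^ (N - 1)) ^ α)⁻¹ ^ 2 := by
  have hβ0 : 0 < α / 2 := by positivity
  have hβ1 : α / 2 < 1 := by linarith
  obtain ⟨c₀, hc₀, hB⟩ := Slade2017_prop331_estimate_abs hd hα0 hα2 hαd (p' := 2 * α) (by positivity)
  have h2α : (2 : ℝ) ^ (-α) < 1 := Real.rpow_lt_one_of_one_lt_of_neg (by norm_num) (by linarith)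
  have h2α0 : 0 < 1 - (2 : ℝ) ^ (-α) := by linarith
  obtain ⟨K, hK⟩ : ∃ K : ℝ, K = c₀ * (1 + mbar) * 2 ^ d / (1 - (2 : ℝ) ^ (-α)) := ⟨_, rfl⟩
  have hK0 : 0 < K := by rw [hK]; positivity
  refine ⟨K, hK0, fun L hL m2 hm2 hm2' N hN M _ hM x y => ?_⟩
  have hLr : (2 : ℝ) ≤ L := by exact_mod_cast hL
  have hLr1 : (1 : ℝ) < L := by linarith
  have hLr0 : (0 : ℝ) < L := by linarith
  -- abbreviations (opaque)
  obtain ⟨c, hc⟩ : ∃ c : Site d → Site d,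
      c = fun z => (fun j => ((x j).val : ℤ)) - fun j => ((y j).val : ℤ) + M * z j := ⟨_, rfl⟩
  obtain ⟨bnd, hbnd⟩ : ∃ bnd : ℕ → ℝ, bnd = fun m => c₀ * ((L : ℝ) ^ (m + N - 1)) ^ (α - d) *
      (1 / (1 + m2 ^ 2 * ((L : ℝ) ^ (m + N - 1)) ^ (2 * α)) +
        1 / (1 + m2 * ((L : ℝ) ^ (m + N - 1)) ^ (2 * α))) := ⟨_, rfl⟩
  have hbnd0 : ∀ m, 0 ≤ bnd m := fun m => by
    rw [hbnd]
    have h1 : 0 ≤ ((L : ℝ) ^ (m + N - 1)) ^ (α - d) := Real.rpow_nonneg (pow_nonneg hLr0.le _) _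
    have h2 : 0 ≤ ((L : ℝ) ^ (m + N - 1)) ^ (2 * α) := Real.rpow_nonneg (pow_nonneg hLr0.le _) _
    positivity
  obtain ⟨G, hG⟩ : ∃ G : ℝ, G = c₀ * (1 + mbar) * 2 ^ d * (m2⁻¹ ^ 2 * ((L : ℝ) ^ (N - 1)) ^ (-(α + d))) :=
    ⟨_, rfl⟩
  have hG0 : 0 ≤ G := by
    rw [hG]
    have := Real.rpow_nonneg (pow_nonneg hLr0.le (N - 1)) (-(α + d))
    positivity
  obtain ⟨r, hr⟩ : ∃ r : ℝ, r = (L : ℝ) ^ (-α) := ⟨_, rfl⟩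
  have hr0 : 0 ≤ r := by rw [hr]; exact Real.rpow_nonneg hLr0.le _
  have hr2 : r ≤ (2 : ℝ) ^ (-α) := by
    rw [hr]
    exact Real.rpow_le_rpow_of_nonpos (by norm_num) hLr (by linarith)
  have hr1 : r < 1 := lt_of_le_of_lt hr2 h2α
  -- Step 1: the real estimate of the summed bounds
  have hE : ∀ m, ((L : ℝ) ^ m + 1) ^ d * bnd m ≤ G * r ^ m := by
    intro m
    have hℓ : 0 < (L : ℝ) ^ (m + N - 1) := pow_pos hLr0 _
    have ht := two_terms_le (d := d) hℓ (α := α) hm2 hm2'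
    have hp := pow_count_le (d := d) hLr1.le α hN m
    have hfac : 0 ≤ ((L : ℝ) ^ m + 1) ^ d := by positivity
    calc ((L : ℝ) ^ m + 1) ^ d * bnd m
        = c₀ * (((L : ℝ) ^ m + 1) ^ d * (((L : ℝ) ^ (m + N - 1)) ^ (α - d) *
            (1 / (1 + m2 ^ 2 * ((L : ℝ) ^ (m + N - 1)) ^ (2 * α)) +
              1 / (1 + m2 * ((L : ℝ) ^ (m + N - 1)) ^ (2 * α))))) := by rw [hbnd]; ring
      _ ≤ c₀ * (((L : ℝ) ^ m + 1) ^ d * ((1 + mbar) * (m2⁻¹ ^ 2 * ((L : ℝ) ^ (m + N - 1)) ^ (-(α + d))))) :=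
          mul_le_mul_of_nonneg_left (mul_le_mul_of_nonneg_left ht hfac) hc₀.le
      _ = c₀ * (1 + mbar) * m2⁻¹ ^ 2 * (((L : ℝ) ^ m + 1) ^ d * ((L : ℝ) ^ (m + N - 1)) ^ (-(α + d))) := by
          ring
      _ ≤ c₀ * (1 + mbar) * m2⁻¹ ^ 2 * (2 ^ d * ((L : ℝ) ^ (-α)) ^ m * ((L : ℝ) ^ (N - 1)) ^ (-(α + d))) :=
          mul_le_mul_of_nonneg_left hp (by positivity)
      _ = G * r ^ m := by rw [hG, hr]; ring
  have hsumm : Summable fun m : ℕ => ((L : ℝ) ^ m + 1) ^ d * bnd m :=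
    Summable.of_nonneg_of_le (fun m => mul_nonneg (by positivity) (hbnd0 m)) hE
      ((summable_geometric_of_lt_one hr0 hr1).mul_left G)
  have htsum : ∑' m : ℕ, ((L : ℝ) ^ m + 1) ^ d * bnd m ≤ G / (1 - (2 : ℝ) ^ (-α)) := by
    calc ∑' m : ℕ, ((L : ℝ) ^ m + 1) ^ d * bnd m ≤ ∑' m : ℕ, G * r ^ m :=
          hsumm.tsum_le_tsum hE ((summable_geometric_of_lt_one hr0 hr1).mul_left G)
      _ = G * (1 - r)⁻¹ := by rw [tsum_mul_left, tsum_geometric_of_lt_one hr0 hr1]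
      _ ≤ G / (1 - (2 : ℝ) ^ (-α)) := by
          rw [div_eq_mul_inv]
          exact mul_le_mul_of_nonneg_left (inv_anti₀ h2α0 (by linarith)) hG0
  -- the target in terms of `G`
  have htarget : G / (1 - (2 : ℝ) ^ (-α)) =
      K * ((L : ℝ) ^ (N - 1)) ^ (α - d) * (m2 * ((L : ℝ) ^ (N - 1)) ^ α)⁻¹ ^ 2 := by
    have hℓ0 : 0 < (L : ℝ) ^ (N - 1) := pow_pos hLr0 _
    have hpow : ((L : ℝ) ^ (N - 1)) ^ (-(α + d)) =
        ((L : ℝ) ^ (N - 1)) ^ (α - d) * (((L : ℝ) ^ (N - 1)) ^ α)⁻¹ ^ 2 := by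
      rw [inv_pow, ← Real.rpow_natCast (((L : ℝ) ^ (N - 1)) ^ α) 2, ← Real.rpow_mul hℓ0.le,
        ← Real.rpow_neg hℓ0.le, ← Real.rpow_add hℓ0]
      congr 1
      push_cast
      ring
    rw [hG, hK, hpow, mul_inv, mul_pow]
    ring
  have hKPQ0 : 0 ≤ K * ((L : ℝ) ^ (N - 1)) ^ (α - d) * (m2 * ((L : ℝ) ^ (N - 1)) ^ α)⁻¹ ^ 2 := by
    rw [← htarget]
    exact div_nonneg hG0 h2α0.le
  -- Step 2: the `ℝ≥0∞` chain
  have hI : ∀ z m, ∫ s in Ioi 0, |Gam d L s (m + N) (c z)| * Kato.katoDensity (α / 2) m2 s ≤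
      (if (((∑ i, ((c z) i).natAbs : ℕ) : ℝ)) < (L : ℝ) ^ (m + N) / 2 then bnd m else 0) := by
    intro z m
    split_ifs with hz
    · have h := hB L hLr m2 hm2.le (m + N) (by omega) (c z)
      rw [hbnd]
      exact h
    · have h0 : EqOn (fun s : ℝ => |Gam d L s (m + N) (c z)| * Kato.katoDensity (α / 2) m2 s)
          (fun _ => 0) (Ioi 0) := fun s hs => by
        simp only
        rw [Gam_eq_zero hd hLr0.le (le_of_lt hs) (m + N) (c z) (not_lt.1 hz), abs_zero, zero_mul]
      rw [setIntegral_congr_fun measurableSet_Ioi h0, integral_zero]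
  have hZ : ∀ m, ∑' z : Site d, ENNReal.ofReal
      (if (((∑ i, ((c z) i).natAbs : ℕ) : ℝ)) < (L : ℝ) ^ (m + N) / 2 then bnd m else 0) ≤
        ENNReal.ofReal (((L : ℝ) ^ m + 1) ^ d * bnd m) := by
    intro m
    have hfin := finite_periodiseIndex x y ((L : ℝ) ^ (m + N) / 2)
    have hmem : ∀ z : Site d, z ∈ hfin.toFinset ↔
        (((∑ i, ((c z) i).natAbs : ℕ) : ℝ)) < (L : ℝ) ^ (m + N) / 2 := fun z => by
      rw [Set.Finite.mem_toFinset, hc]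
      rfl
    rw [tsum_eq_sum (s := hfin.toFinset) (fun z hz => by
      rw [if_neg ((hmem z).not.1 hz), ENNReal.ofReal_zero])]
    rw [Finset.sum_congr rfl (fun z hz => by rw [if_pos ((hmem z).1 hz)]), Finset.sum_const,
      nsmul_eq_mul]
    have hcard := card_periodiseIndex_le x y (r := (L : ℝ) ^ (m + N) / 2) (by positivity)
    have hLm : 2 * ((L : ℝ) ^ (m + N) / 2) / M + 1 = (L : ℝ) ^ m + 1 := by
      rw [hM]
      push_cast
      rw [pow_add]
      field_simp
    rw [hLm] at hcard
    calc (hfin.toFinset.card : ℝ≥0∞) * ENNReal.ofReal (bnd m)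
        = ENNReal.ofReal (hfin.toFinset.card : ℝ) * ENNReal.ofReal (bnd m) := by
          rw [ENNReal.ofReal_natCast]
      _ ≤ ENNReal.ofReal (((L : ℝ) ^ m + 1) ^ d) * ENNReal.ofReal (bnd m) :=
          mul_le_mul_of_nonneg_right (ENNReal.ofReal_le_ofReal hcard) bot_le
      _ = ENNReal.ofReal (((L : ℝ) ^ m + 1) ^ d * bnd m) := (ENNReal.ofReal_mul (by positivity)).symm
  have hchain : ∫⁻ s in Ioi 0, ENNReal.ofReal (|GamNN d L s N M x y| * Kato.katoDensity (α / 2) m2 s) ≤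
      ENNReal.ofReal (G / (1 - (2 : ℝ) ^ (-α))) := by
    calc ∫⁻ s in Ioi 0, ENNReal.ofReal (|GamNN d L s N M x y| * Kato.katoDensity (α / 2) m2 s)
        ≤ ∑' z : Site d, ∑' m : ℕ, ENNReal.ofReal (∫ s in Ioi 0,
            |Gam d L s (m + N) (c z)| * Kato.katoDensity (α / 2) m2 s) := by
          rw [hc]
          exact lintegral_abs_GamNN_mul_le hd hβ0 hβ1 hLr1 hm2 hN x y
      _ ≤ ∑' z : Site d, ∑' m : ℕ, ENNReal.ofReal
            (if (((∑ i, ((c z) i).natAbs : ℕ) : ℝ)) < (L : ℝ) ^ (m + N) / 2 then bnd m else 0) :=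
          ENNReal.tsum_le_tsum fun z => ENNReal.tsum_le_tsum fun m => ENNReal.ofReal_le_ofReal (hI z m)
      _ = ∑' m : ℕ, ∑' z : Site d, ENNReal.ofReal
            (if (((∑ i, ((c z) i).natAbs : ℕ) : ℝ)) < (L : ℝ) ^ (m + N) / 2 then bnd m else 0) :=
          ENNReal.tsum_comm
      _ ≤ ∑' m : ℕ, ENNReal.ofReal (((L : ℝ) ^ m + 1) ^ d * bnd m) := ENNReal.tsum_le_tsum hZ
      _ = ENNReal.ofReal (∑' m : ℕ, ((L : ℝ) ^ m + 1) ^ d * bnd m) :=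
          (ENNReal.ofReal_tsum_of_nonneg (fun m => mul_nonneg (by positivity) (hbnd0 m)) hsumm).symm
      _ ≤ ENNReal.ofReal (G / (1 - (2 : ℝ) ^ (-α))) := ENNReal.ofReal_le_ofReal htsum
  -- Step 3: back to `ℝ`
  have hint := integrableOn_abs_GamNN_mul_katoDensity hd hβ0 hβ1 hLr1 hm2 hN x y
  have hnn : 0 ≤ᵐ[(volume : Measure ℝ).restrict (Ioi 0)]
      fun s : ℝ => |GamNN d L s N M x y| * Kato.katoDensity (α / 2) m2 s :=
    (ae_restrict_iff' measurableSet_Ioi).2 (Eventually.of_forall fun s hs =>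
      mul_nonneg (abs_nonneg _) (Kato.katoDensity_pos hβ0 hβ1 m2 hs).le)
  calc |fracCovNN d L α m2 N M x y|
      ≤ ∫ s in Ioi 0, |GamNN d L s N M x y * Kato.katoDensity (α / 2) m2 s| := by
        unfold fracCovNN
        exact abs_integral_le_integral_abs
    _ = ∫ s in Ioi 0, |GamNN d L s N M x y| * Kato.katoDensity (α / 2) m2 s := by
        refine setIntegral_congr_fun measurableSet_Ioi fun s hs => ?_
        rw [abs_mul, abs_of_nonneg (Kato.katoDensity_pos hβ0 hβ1 m2 hs).le]
    _ = (∫⁻ s in Ioi 0, ENNReal.ofReal (|GamNN d L s N M x y| * Kato.katoDensity (α / 2) m2 s)).toReal :=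
        integral_eq_lintegral_of_nonneg_ae hnn hint.aestronglyMeasurable
    _ ≤ G / (1 - (2 : ℝ) ^ (-α)) :=
        ENNReal.toReal_le_of_le_ofReal (div_nonneg hG0 h2α0.le) hchain
    _ = K * ((L : ℝ) ^ (N - 1)) ^ (α - d) * (m2 * ((L : ℝ) ^ (N - 1)) ^ α)⁻¹ ^ 2 := htarget

end FRD

end LongRangePhi4

end Literature.Barriers.CriticalPhenomena
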